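import Literature.MathematicalPhysics.QuantumFieldTheory.ConformalBootstrap3D.PointKernelK34L515.Cert

/-!
# K34L515 instance, cell `l6c7` (parts file: groups 1:21,1:28)

Kernel-v3 cell of the point-functional exclusion instance for the lower box `Δσ ∈ [0.515, 0.520]`,
`Δε ∈ [0.6, 0.95)` (certificate `certL515`, module `PointKernelK34L515.Cert`): spin `ℓ = 6`,
`Δ ∈ [241/32, 121/16)` (centre `A`, half-width `2^-6`), Taylor degree `3`, `n_F = 50`, `2` s-piece(s)
covering `s = Δσ ∈ [103/200, 13/25]`.  Group theorems `l6c7_part<i>_<a>_<b> : gPart … = some <literal>` are checked by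
`decide +kernel` (the literals were produced by `#eval` of the same function); the cell numbers `l6c7_num<i> ≥ 0`
likewise; `l6c7_block` is `PKTM.blockPositive_of_cellPass` applied to them. This file holds only group theorems (the cell stated as a literal); the final file of the cell imports it.  Generated by
`gen/mk_v3cell.py` / `gen/drive_v3.py` (typer-g8).  [folklore]
-/

set_option Elab.async false

namespace Literature.MathematicalPhysics.QuantumFieldTheory.ConformalBootstrap3D

namespace PointKernelK34L515

open PointKernel PKTM
open Literature.Analysis.ValidatedNumerics.PolyMP
open Literature.Analysis.ValidatedNumerics.NumericsMP

/-- group model literal [folklore] -/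
def l6c7_g1_21_28 : G3 := ([⟨-892968639043829580981661076813446478953, -892968638117637793249759569419201883087⟩, ⟨1593375138642554516467383850925968586, 1593375816452097869981409463739227854⟩, ⟨-865447787653762484785687435912180515, -865447103568406041522389224348181107⟩, ⟨-3567685732451255857116473740710831499, -3567685143197524380804058943249904836⟩], [⟨4951598101266904757608279971905678529, 4951598106119607262642893993394424589⟩, ⟨-18254172333283284224768911549430221, -18254168696332441196809896570885095⟩, ⟨16530054388790402634260521391317527, 16530058075219112963454670127698185⟩, ⟨16275422879324616954046659773110126, 16275426070851446762665437486882401⟩], [⟨-13492348570537656135871513753871155, -13492348557759300152122111880522429⟩, ⟨21914054672182302648336440544117, 21914064394113115067778687299227⟩, ⟨-59020634652869124216020512567828, -59020624761319355540835913574636⟩, ⟨-39441225174594072284124553182643, -39441216573265273112551519817919⟩])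

/-- group model literal [folklore] -/
def l6c7_g1_28_34 : G3 := ([⟨487869595361391658680750164107599283263, 487869596380052139954186836651828296375⟩, ⟨16461287098410284943591042479300250436, 16461287832401618808377143230840464692⟩, ⟨3271931291317075717852789921582420468, 3271932030710105472342417000141024500⟩, ⟨1903715029324515228705855651747914640, 1903715671039080108930060671733399777⟩], [⟨-2870831824211939098936835316137426839, -2870831818487342795858101802106661648⟩, ⟨-123934704275217967600576766172811812, -123934700064057028360921743312400924⟩, ⟨-24210793086753517281393594591307421, -24210788832488952808999073060972623⟩, ⟨-9317156085431875863057346459460145, -9317152381035059305472221613114657⟩], [⟨8633306369111090337542400538892801, 8633306385432736561142660691393706⟩, ⟨461108332699576244820755718015797, 461108344850223674187773410635345⟩, ⟨74868961329106771356011904389196, 74868973639198808247681260900952⟩, ⟨25355418689562460597033811773589, 25355429443393908564585293556669⟩])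

/-- group `[21, 28)` of piece 1 [folklore] -/
theorem l6c7_part1_21_28 : gPart certL515 (⟨6, ((483 : ℚ) / 64), 6, 3, 50, 6, 64, ⟨3, 0, 5, 99, 0, 0⟩⟩ : TMCell) (pc ps2 1) 21 28 = some l6c7_g1_21_28 := by decide +kernel

/-- group `[28, 34)` of piece 1 [folklore] -/
theorem l6c7_part1_28_34 : gPart certL515 (⟨6, ((483 : ℚ) / 64), 6, 3, 50, 6, 64, ⟨3, 0, 5, 99, 0, 0⟩⟩ : TMCell) (pc ps2 1) 28 34 = some l6c7_g1_28_34 := by decide +kernel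

end PointKernelK34L515

end Literature.MathematicalPhysics.QuantumFieldTheory.ConformalBootstrap3D
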